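import Literature.AnabelianGeometry.SemiGraphs.AmbientArrowClassesLaws
import Literature.AnabelianGeometry.SemiGraphs.LocalizationSquareLaws

/-!
# Isomorphisms of the Rmk 2.4.2 category are locally trivial ([SemiAnbd] Def 2.2 (ii), Rmk 2.4.2)

Mochizuki, *Semi-graphs of anabelioids*, Publ. RIMS **42** (2006), §2 Def 2.2 (ii) p.24 (locally
trivial morphisms: every constituent 1-morphism of anabelioids is an isomorphism), Rmk 2.4.2 p.26 (the
1-category of semi-graphs of anabelioids, 1-morphisms up to 2-isomorphism) (kurims
`paper:url-f33ace170ff4`). [cite: MochizukiSemiAnbd2006, Def 2.2 (ii), p. 24]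

PROOF-ONLY (L3 bridge; used by the residual-(R2) discharge: an automorphism of an object of `SgA`
fixing a vertex `v` induces a SELF-EQUIVALENCE of the constituent anabelioid at `v`): if an arrow of
`SgAQuot` is an isomorphism, every representative 1-morphism is locally trivial —
`SgAQuot.locallyTrivial_of_isIso`, `SgAQuot.isEquivalence_φV_of_iso`, `…_φE_of_iso`.  Mechanism: from
`hom ≫ inv = 𝟙` one gets (after rebasing the composite over `𝟙`, `SgAQuot.homMk_rebase`) a 2-cell
with the identity 1-morphism, so `ψ'_{f v}^* ⋙ ψ_v^*` is an equivalence, and symmetrically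
`ψ_{f' f v}^* ⋙ ψ'_{f v}^*`; a functor squeezed between two such composites is an equivalence
(`Functor.isEquivalence_of_comp_of_comp`, pure category theory), whence so is `ψ_v^*`.  No definitions.
-/

namespace CategoryTheory.Functor

universe v₁ v₂ v₃ v₄ u₁ u₂ u₃ u₄

variable {A : Type u₁} [Category.{v₁} A] {B : Type u₂} [Category.{v₂} B] {C : Type u₃}
  [Category.{v₃} C] {D : Type u₄} [Category.{v₄} D]

/-- A functor `Q` such that `Q ⋙ P` and `P'' ⋙ Q` are equivalences (for some `P`, `P''`) is an
equivalence: it has a quasi-retraction and a quasi-section, which then agree. (Dot-notation extension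
of Mathlib's `CategoryTheory.Functor`, pure category theory.) [folklore] -/
private theorem isEquivalence_of_comp_of_comp (P'' : A ⥤ B) (Q : B ⥤ C) (P : C ⥤ D)
    [(Q ⋙ P).IsEquivalence] [(P'' ⋙ Q).IsEquivalence] : Q.IsEquivalence := by
  -- quasi-retraction `R` (`Q ⋙ R ≅ 𝟭`) and quasi-section `S` (`S ⋙ Q ≅ 𝟭`)
  let R : C ⥤ B := P ⋙ (Q ⋙ P).inv
  let ηR : Q ⋙ R ≅ 𝟭 B := (Functor.associator Q P (Q ⋙ P).inv).symm ≪≫ (Q ⋙ P).asEquivalence.unitIso.symm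
  let S : C ⥤ B := (P'' ⋙ Q).inv ⋙ P''
  let εS : S ⋙ Q ≅ 𝟭 C := Functor.associator _ _ _ ≪≫ (P'' ⋙ Q).asEquivalence.counitIso
  -- `Q ⋙ S ≅ Q ⋙ S ⋙ (Q ⋙ R) = Q ⋙ (S ⋙ Q) ⋙ R ≅ Q ⋙ R ≅ 𝟭`
  let η : 𝟭 B ≅ Q ⋙ S :=
    ηR.symm ≪≫ Functor.isoWhiskerLeft Q (R.leftUnitor.symm ≪≫ Functor.isoWhiskerRight εS.symm R ≪≫
      Functor.associator S Q R ≪≫ Functor.isoWhiskerLeft S ηR ≪≫ S.rightUnitor)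
  exact (Equivalence.mk Q S η εS).isEquivalence_functor

end CategoryTheory.Functor

namespace Literature.AnabelianGeometry.SemiGraphs

open CategoryTheory Literature.AnabelianGeometry.Anabelioids

universe v₁ u₁ u

namespace SemiGraphOfAnabelioids

variable {𝒢 : SemiGraphOfAnabelioids.{v₁, u₁, u}}

/-- A 1-morphism over a base EQUAL to the identity which, once rebased over the identity, is
2-isomorphic to the identity 1-morphism has all its vertex components equivalences.
[cite: MochizukiSemiAnbd2006, Rmk 2.4.2, p. 26] -/
theorem HomOver.isEquivalence_φV_of_iso2_id {g : 𝒢.graph ⟶ 𝒢.graph} (χ : HomOver 𝒢 𝒢 g)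
    (r : g = 𝟙 𝒢.graph) (σ : HomOver.Iso2 (χ.rebase (𝟙 𝒢.graph) r) (HomOver.id 𝒢))
    (v : 𝒢.graph.Vertex) : (χ.φV v).pullback.IsEquivalence := by
  subst r
  have e : (𝟭 (𝒢.V v) ⋙ (χ.φV v).pullback) ≅ 𝟭 (𝒢.V v) := σ.isoV v
  exact @Functor.isEquivalence_of_iso _ _ _ _ _ _ e.symm (Functor.isEquivalence_refl)

/-- Edge companion of `isEquivalence_φV_of_iso2_id`. [cite: MochizukiSemiAnbd2006, Rmk 2.4.2, p. 26] -/
theorem HomOver.isEquivalence_φE_of_iso2_id {g : 𝒢.graph ⟶ 𝒢.graph} (χ : HomOver 𝒢 𝒢 g)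
    (r : g = 𝟙 𝒢.graph) (σ : HomOver.Iso2 (χ.rebase (𝟙 𝒢.graph) r) (HomOver.id 𝒢))
    (e : 𝒢.graph.Edge) : (χ.φE e (g.edgeMap e) rfl).pullback.IsEquivalence := by
  subst r
  have i : (χ.φE e e rfl).pullback ≅ 𝟭 (𝒢.E e) := σ.isoE e e rfl
  exact @Functor.isEquivalence_of_iso _ _ _ _ _ _ i.symm (Functor.isEquivalence_refl)

end SemiGraphOfAnabelioids

namespace SgAQuot

open SemiGraphOfAnabelioids

variable {X Y : SgAQuot.{v₁, u₁, u}}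

/-- From `homMk ψ ≫ homMk ψ' = 𝟙`: the composite 1-morphism, rebased over the identity, is
2-isomorphic to the identity 1-morphism. [cite: MochizukiSemiAnbd2006, Rmk 2.4.2, p. 26] -/
theorem exists_iso2_id_of_comp_eq_id {f : X.toSgA.graph ⟶ Y.toSgA.graph}
    {f' : Y.toSgA.graph ⟶ X.toSgA.graph} (ψ : HomOver X.toSgA Y.toSgA f)
    (ψ' : HomOver Y.toSgA X.toSgA f') (h : homMk ψ ≫ homMk ψ' = 𝟙 X) :
    ∃ r : f ≫ f' = 𝟙 X.toSgA.graph,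
      Nonempty (HomOver.Iso2 ((ψ.comp ψ').rebase (𝟙 X.toSgA.graph) r) (HomOver.id X.toSgA)) := by
  have r : f ≫ f' = 𝟙 X.toSgA.graph := congrArg SgAQuot.Hom.base h
  refine ⟨r, (homMk_eq_homMk_iff _ _).mp ?_⟩
  rw [SgAQuot.homMk_rebase, ← homMk_comp_homMk, h]
  exact (homMk_id X).symm

/-- **The vertex components of (any representative of) an isomorphism of the Rmk 2.4.2 category are
equivalences.** [cite: MochizukiSemiAnbd2006, Def 2.2 (ii), p. 24] -/
theorem isEquivalence_φV_of_iso (a : X ≅ Y) {f : X.toSgA.graph ⟶ Y.toSgA.graph}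
    (ψ : HomOver X.toSgA Y.toSgA f) (hψ : homMk ψ = a.hom) (v : X.toSgA.graph.Vertex) :
    (ψ.φV v).pullback.IsEquivalence := by
  rcases hinv : a.inv with ⟨f', c'⟩
  induction c' using Quotient.ind with
  | _ ψ' =>
    have ha' : a.inv = homMk ψ' := hinv
    -- `ψ'_{f v}^* ⋙ ψ_v^*` is an equivalence
    have h₁ : homMk ψ ≫ homMk ψ' = 𝟙 X := by rw [hψ, ← ha', a.hom_inv_id]
    obtain ⟨r₁, ⟨σ₁⟩⟩ := exists_iso2_id_of_comp_eq_id ψ ψ' h₁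
    haveI e₁ : ((ψ'.φV (f.vertexMap v)).pullback ⋙ (ψ.φV v).pullback).IsEquivalence :=
      HomOver.isEquivalence_φV_of_iso2_id (ψ.comp ψ') r₁ σ₁ v
    -- `ψ_{f' f v}^* ⋙ ψ'_{f v}^*` is an equivalence
    have h₂ : homMk ψ' ≫ homMk ψ = 𝟙 Y := by rw [hψ, ← ha', a.inv_hom_id]
    obtain ⟨r₂, ⟨σ₂⟩⟩ := exists_iso2_id_of_comp_eq_id ψ' ψ h₂
    haveI e₂ : ((ψ.φV (f'.vertexMap (f.vertexMap v))).pullback ⋙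
        (ψ'.φV (f.vertexMap v)).pullback).IsEquivalence :=
      HomOver.isEquivalence_φV_of_iso2_id (ψ'.comp ψ) r₂ σ₂ (f.vertexMap v)
    haveI : (ψ'.φV (f.vertexMap v)).pullback.IsEquivalence :=
      Functor.isEquivalence_of_comp_of_comp (ψ.φV (f'.vertexMap (f.vertexMap v))).pullback
        (ψ'.φV (f.vertexMap v)).pullback (ψ.φV v).pullback
    exact Functor.isEquivalence_of_comp_left (ψ'.φV (f.vertexMap v)).pullback _

/-- **The edge components of (any representative of) an isomorphism of the Rmk 2.4.2 category are
equivalences.** [cite: MochizukiSemiAnbd2006, Def 2.2 (ii), p. 24] -/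
theorem isEquivalence_φE_of_iso (a : X ≅ Y) {f : X.toSgA.graph ⟶ Y.toSgA.graph}
    (ψ : HomOver X.toSgA Y.toSgA f) (hψ : homMk ψ = a.hom) (e : X.toSgA.graph.Edge) :
    (ψ.φE e (f.edgeMap e) rfl).pullback.IsEquivalence := by
  rcases hinv : a.inv with ⟨f', c'⟩
  induction c' using Quotient.ind with
  | _ ψ' =>
    have ha' : a.inv = homMk ψ' := hinv
    have h₁ : homMk ψ ≫ homMk ψ' = 𝟙 X := by rw [hψ, ← ha', a.hom_inv_id]
    obtain ⟨r₁, ⟨σ₁⟩⟩ := exists_iso2_id_of_comp_eq_id ψ ψ' h₁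
    haveI e₁ : ((ψ'.φE (f.edgeMap e) (f'.edgeMap (f.edgeMap e)) rfl).pullback ⋙
        (ψ.φE e (f.edgeMap e) rfl).pullback).IsEquivalence :=
      HomOver.isEquivalence_φE_of_iso2_id (ψ.comp ψ') r₁ σ₁ e
    have h₂ : homMk ψ' ≫ homMk ψ = 𝟙 Y := by rw [hψ, ← ha', a.inv_hom_id]
    obtain ⟨r₂, ⟨σ₂⟩⟩ := exists_iso2_id_of_comp_eq_id ψ' ψ h₂
    haveI e₂ : ((ψ.φE (f'.edgeMap (f.edgeMap e)) (f.edgeMap (f'.edgeMap (f.edgeMap e))) rfl).pullback ⋙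
        (ψ'.φE (f.edgeMap e) (f'.edgeMap (f.edgeMap e)) rfl).pullback).IsEquivalence :=
      HomOver.isEquivalence_φE_of_iso2_id (ψ'.comp ψ) r₂ σ₂ (f.edgeMap e)
    haveI : (ψ'.φE (f.edgeMap e) (f'.edgeMap (f.edgeMap e)) rfl).pullback.IsEquivalence :=
      Functor.isEquivalence_of_comp_of_comp
        (ψ.φE (f'.edgeMap (f.edgeMap e)) (f.edgeMap (f'.edgeMap (f.edgeMap e))) rfl).pullback
        (ψ'.φE (f.edgeMap e) (f'.edgeMap (f.edgeMap e)) rfl).pullback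
        (ψ.φE e (f.edgeMap e) rfl).pullback
    exact Functor.isEquivalence_of_comp_left
      (ψ'.φE (f.edgeMap e) (f'.edgeMap (f.edgeMap e)) rfl).pullback _

/-- **Isomorphisms of the Rmk 2.4.2 category are locally trivial** (every representative 1-morphism
has all its constituents isomorphisms of anabelioids). [cite: MochizukiSemiAnbd2006, Def 2.2 (ii), p. 24] -/
theorem locallyTrivial_of_isIso (a : X ≅ Y) : locallyTrivial a.hom := by
  rcases ha : a.hom with ⟨f, c⟩
  induction c using Quotient.ind with
  | _ ψ =>
    have hψ : homMk ψ = a.hom := ha.symm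
    exact (homMk_mem_locallyTrivial_iff ψ).mpr
      ⟨fun v => isEquivalence_φV_of_iso a ψ hψ v, fun e => isEquivalence_φE_of_iso a ψ hψ e⟩

/-- An automorphism of an object of the ambient category `SgA` is locally trivial.
[cite: MochizukiSemiAnbd2006, Def 2.2 (ii), p. 24] -/
theorem SgA.locallyTrivial_of_iso {X Y : SgA.{v₁, u₁, u}} (a : X ≅ Y) : locallyTrivial a.hom.hom.hom :=
  locallyTrivial_of_isIso ((IsAmbientObj.ι ⋙ wideSubcategoryInclusion _).mapIso a)

end SgAQuot

end Literature.AnabelianGeometry.SemiGraphs
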